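import Summits.AtomisticToContinuum.BoseEinsteinCondensation.Theorems.BECConjugateDominationHardCoreExtensionTruncationReduction
import Summits.AtomisticToContinuum.BoseEinsteinCondensation.Theorems.BECConjugateDominationHardCoreExtensionGradientCauchy
import Literature.MathematicalPhysics.QuantumManyBody.PeriodicKineticBudget
import Literature.MathematicalPhysics.QuantumManyBody.PeriodicClusteringFromKyFanGap
import Literature.MathematicalPhysics.QuantumManyBody.PeriodicBoseGasMomentumSector
import HarnessLib

/-!
# Kinetic tightness of near-optimal orthonormal pairs along the truncations (line `third-law-current-floor`,
# crux `HardCoreExtension`, stmt-AtomisticToContinuum-11786; node Q3 of the (α'₂) pair programme)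

At fixed `(N, L)`, `L > 0`, let `wₙ = min(v, n)` be the truncations of a measurable pair potential `v`, let
`K₂(wₙ) = kyFanTwo wₙ N L ≤ B < ⊤` be the truncated Ky Fan two-levels (monotone in `n`), and let
`(Ψ₁ n, Ψ₂ n)` be `L²(cell)`-orthogonal pairs of trial states that are `1/(n+1)`-optimal for `K₂(wₙ)`.
GIVEN the trace-Cauchy estimate for near-optimal orthonormal pairs of two truncations (node Q2, the antecedent
of the implication), along a subsequence `φ` the total kinetic energy of the pair `(Ψ₁ (φ i), Ψ₂ (φ i))` does
NOT concentrate on any shrinking measurable family `S k` with Lebesgue-null limit in the cell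
(`stub_pairKineticTightness_of`).

Proof (the two-state analogue of `stub_truncationMinimisersKineticTightness`). (P1) Both components have
truncated energies `≤ B + 1`; two successive Rellich extractions (`exists_subseq_sq_cauchy_of_le`, the second
one on `n ↦ Ψ₂ (φ₁ n)` using `q_{wₙ} ≤ q_{w_{φ₁ n}}`) make both components `L²(cell)`-Cauchy along
`φ = φ₁ ∘ φ₂`. (P2) The monotone bounded levels `K₂(wₙ)` have small increments
(`exists_kyFanTwo_increment_le`); the trace-Cauchy estimate between the `φ i₀`-pair and the `φ i`-pair then
makes `∑ᵢ ∫_cell |∇(Ψᵢ(φ i) − Ψᵢ(φ i₀))|²` small. (P3) Pointwise `|∇Ψᵢ|² ≤ 2|∇Ψᵢ⁰|² + 2|∇(Ψᵢ − Ψᵢ⁰)|²` and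
absolute continuity of the finite integral `∫_cell |∇Ψ₁⁰|² + |∇Ψ₂⁰|²` (`exists_setLIntegral_inter_cellN_le`).
The helpers are the line-by-line analogues of those of `…HardCoreExtensionKineticTightness.lean`
(`stub_truncationMinimisersKineticTightness`), restated in the form used here. [folklore; the convexity
argument of LiebLoss2001 Thm 11.8]
-/

noncomputable section

namespace Summit.AtomisticToContinuum.BoseEinsteinCondensation.Cruxes.HardCoreExtension.ThirdLawCurrentFloor

open MeasureTheory Filter
open scoped ENNReal NNReal BigOperators Topology ComplexConjugate
open Literature.MathematicalPhysics.QuantumManyBody.BoseGas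

namespace PairKineticTightness

variable {N : ℕ} {L : ℝ}

/-! ### Monotonicity of the truncated Ky Fan two-levels -/

/-- The truncated Ky Fan two-levels `n ↦ K₂(min(v, n)) = kyFanTwo (min v n) N L` are monotone in the truncation
level (`v ↦ K₂(v)` is monotone: `iInf_mono` + `periodicEnergy_mono_of_le`). [folklore] -/
theorem kyFanTwo_truncation_monotone (v : ℝ → ℝ≥0∞) (N : ℕ) (L : ℝ) :
    Monotone fun n : ℕ => kyFanTwo (fun r => min (v r) (n : ℝ≥0∞)) N L := by
  intro m n hmn
  have hw : ∀ r, min (v r) (m : ℝ≥0∞) ≤ min (v r) (n : ℝ≥0∞) := fun r =>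
    min_le_min le_rfl (by exact_mod_cast hmn)
  exact iInf_mono fun Ψ₁ => iInf_mono fun Ψ₂ => iInf_mono fun _ =>
    add_le_add (periodicEnergy_mono_of_le hw Ψ₁) (periodicEnergy_mono_of_le hw Ψ₂)

/-! ### Variants of the four helper lemmas of `…HardCoreExtensionKineticTightness.lean`

Restated in the form used below (reindexed energies, Ky Fan levels, `∃ k₀` form), with the proofs of
`KineticTightness.exists_subseq_sq_cauchy`, `.exists_increment_le`, `.kineticDensity_le_two_mul`,
`.tendsto_setLIntegral_inter_cellN_zero` adapted line by line (that module is not yet built on the farm, so it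
is not imported here). -/

/-- **`L²(cell)`-Cauchy subsequence, reindexed energies.** A sequence of trial states `Ψ n` whose
`θ n`-truncated energies are `≤ B < ⊤` for some `θ n ≥ n` (hence so are the `n`-truncated ones,
`periodicEnergy_mono_of_le`) has an `L²(cell)`-Cauchy subsequence: Rellich through the free form domain
(`exists_limitProfile_of_seq`; a convergent sequence is Cauchy) and the isometry
`norm_formEmbed_sub_sq_trialState` on differences; the squared distance is finite (`≤ 4`). [folklore] -/
theorem exists_subseq_sq_cauchy_of_le {v : ℝ → ℝ≥0∞} (hv : Measurable v) (hL : 0 < L) {B : ℝ≥0∞}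
    (hB : B ≠ ⊤) (Ψ : ℕ → PeriodicTrialState N L) (θ : ℕ → ℕ) (hθ : ∀ n : ℕ, n ≤ θ n)
    (hΨ : ∀ n : ℕ, periodicEnergy (fun r => min (v r) ((θ n : ℕ) : ℝ≥0∞)) (Ψ n) ≤ B) :
    ∃ φ : ℕ → ℕ, StrictMono φ ∧ ∀ δ : ℝ, 0 < δ → ∃ I : ℕ, ∀ i j : ℕ, I ≤ i → I ≤ j →
      ∫⁻ X in cellN N L, ((‖(Ψ (φ i)).ψ X - (Ψ (φ j)).ψ X‖₊ : ℝ≥0∞)) ^ 2 ≤ ENNReal.ofReal δ := by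
  have hΨ' : ∀ n : ℕ, periodicEnergy (fun r => min (v r) (n : ℝ≥0∞)) (Ψ n) ≤ B := fun n =>
    (periodicEnergy_mono_of_le (fun r => min_le_min le_rfl (by exact_mod_cast hθ n)) _).trans (hΨ n)
  obtain ⟨η, φ, hφ, hconv, -, -, -⟩ := exists_limitProfile_of_seq hv hL hB Ψ hΨ'
  refine ⟨φ, hφ, fun δ hδ => ?_⟩
  obtain ⟨I, hI⟩ := Metric.cauchySeq_iff.1 hconv.cauchySeq (Real.sqrt δ) (by positivity)
  refine ⟨I, fun i j hi hj => ?_⟩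
  have h1 := hI i hi j hj
  rw [dist_eq_norm] at h1
  have hsq := pow_le_pow_left₀ (norm_nonneg _) h1.le 2
  rw [norm_formEmbed_sub_sq_trialState hL (Ψ (φ i)) (Ψ (φ j)), Real.sq_sqrt hδ.le] at hsq
  -- finiteness of the squared distance (≤ 4)
  have hfin : ∫⁻ X in cellN N L, ((‖(Ψ (φ i)).ψ X - (Ψ (φ j)).ψ X‖₊ : ℝ≥0∞)) ^ 2 ≠ ⊤ := by
    have h4 := lintegral_cellN_sq_add_add_sub L (Ψ (φ i)).contDiff.continuous (Ψ (φ j)).contDiff.continuous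
    rw [(Ψ (φ i)).norm_eq, (Ψ (φ j)).norm_eq] at h4
    refine ne_top_of_le_ne_top (by norm_num : (2 * 1 + 2 * 1 : ℝ≥0∞) ≠ ⊤) ?_
    rw [← h4]
    exact le_add_self
  rw [← ENNReal.ofReal_toReal hfin]
  exact ENNReal.ofReal_le_ofReal hsq

/-- **Small increments of the truncated Ky Fan two-levels.** The monotone sequence `n ↦ K₂(min(v, n))`, bounded
by a finite `B`, has uniformly small increments beyond some index (it converges to its supremum in `ℝ≥0∞`).
[folklore] -/
theorem exists_kyFanTwo_increment_le (v : ℝ → ℝ≥0∞) (N : ℕ) (L : ℝ) {B : ℝ≥0∞} (hB : B ≠ ⊤)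
    (hKB : ∀ n : ℕ, kyFanTwo (fun r => min (v r) (n : ℝ≥0∞)) N L ≤ B) {δ : ℝ≥0∞} (hδ : 0 < δ) :
    ∃ I : ℕ, ∀ m n : ℕ, I ≤ m →
      kyFanTwo (fun r => min (v r) (n : ℝ≥0∞)) N L - kyFanTwo (fun r => min (v r) (m : ℝ≥0∞)) N L ≤ δ := by
  set E : ℕ → ℝ≥0∞ := fun n => kyFanTwo (fun r => min (v r) (n : ℝ≥0∞)) N L
  have hmono : Monotone E := kyFanTwo_truncation_monotone v N L
  have hS : (⨆ n, E n) ≠ ⊤ := ne_top_of_le_ne_top hB (iSup_le hKB)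
  obtain ⟨I, hI⟩ := (ENNReal.tendsto_atTop hS).1 (tendsto_atTop_iSup hmono) δ hδ
  refine ⟨I, fun m n hm => ?_⟩
  have h1 : E n ≤ ⨆ n, E n := le_iSup E n
  have h2 : (⨆ n, E n) - δ ≤ E m := (hI m hm).1
  change E n - E m ≤ δ
  rw [tsub_le_iff_right]
  calc E n ≤ ⨆ n, E n := h1
    _ ≤ (⨆ n, E n) - δ + δ := le_tsub_add
    _ ≤ E m + δ := add_le_add h2 le_rfl
    _ = δ + E m := add_comm _ _

/-- **Absolute continuity on the cell, `∃ k₀` form.** A finite integral on the cell is eventually `≤ ε` on a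
shrinking measurable family whose limit is null inside the cell (`tendsto_setLIntegral_zero` for `volume|_cell`,
continuity from above of the finite measure `volume|_cell`, `ENNReal.tendsto_atTop_zero`). [folklore] -/
theorem exists_setLIntegral_inter_cellN_le {f : Config N → ℝ≥0∞}
    (hf : ∫⁻ X in cellN N L, f X ≠ ⊤) (S : ℕ → Set (Config N)) (hS : ∀ k, MeasurableSet (S k))
    (hanti : Antitone S) (hnull : volume ((⋂ k, S k) ∩ cellN N L) = 0) {ε : ℝ≥0∞} (hε : 0 < ε) :
    ∃ k₀ : ℕ, ∀ k : ℕ, k₀ ≤ k → ∫⁻ X in S k ∩ cellN N L, f X ≤ ε := by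
  have hfin : volume (cellN N L) ≠ ⊤ := by
    rw [volume_cellN]; exact ENNReal.pow_ne_top (ENNReal.pow_ne_top ENNReal.ofReal_ne_top)
  have h0 : (volume.restrict (cellN N L)) (S 0) ≠ ⊤ := by
    rw [Measure.restrict_apply (hS 0)]
    exact ne_top_of_le_ne_top hfin (measure_mono Set.inter_subset_right)
  have hmeas : Tendsto ((volume.restrict (cellN N L)) ∘ S) atTop (𝓝 0) := by
    have h := tendsto_measure_iInter_atTop (μ := volume.restrict (cellN N L))
      (fun k => (hS k).nullMeasurableSet) hanti ⟨0, h0⟩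
    rwa [Measure.restrict_apply (MeasurableSet.iInter hS), hnull] at h
  have hT : Tendsto (fun k => ∫⁻ X in S k ∩ cellN N L, f X) atTop (𝓝 0) := by
    refine (tendsto_setLIntegral_zero (μ := volume.restrict (cellN N L)) hf hmeas).congr fun k => ?_
    rw [Measure.restrict_restrict (hS k)]
  exact ENNReal.tendsto_atTop_zero.1 hT ε hε

/-! ### (P1) A common `L²(cell)`-Cauchy subsequence for the pair -/

/-- **Two Rellich extractions.** For two sequences of trial states with truncated energies `≤ B < ⊤` there is
ONE subsequence `φ` along which both are `L²(cell)`-Cauchy: extract `φ₁` for `Ψ₁`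
(`exists_subseq_sq_cauchy_of_le` with `θ = id`), then `φ₂` for `n ↦ Ψ₂ (φ₁ n)` (with `θ = φ₁`, `n ≤ φ₁ n`), and
take `φ = φ₁ ∘ φ₂`. [folklore] -/
theorem exists_subseq_pair_sq_cauchy {v : ℝ → ℝ≥0∞} (hv : Measurable v) (hL : 0 < L) {B : ℝ≥0∞}
    (hB : B ≠ ⊤) (Ψ₁ Ψ₂ : ℕ → PeriodicTrialState N L)
    (h₁ : ∀ n : ℕ, periodicEnergy (fun r => min (v r) (n : ℝ≥0∞)) (Ψ₁ n) ≤ B)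
    (h₂ : ∀ n : ℕ, periodicEnergy (fun r => min (v r) (n : ℝ≥0∞)) (Ψ₂ n) ≤ B) :
    ∃ φ : ℕ → ℕ, StrictMono φ ∧
      (∀ δ : ℝ, 0 < δ → ∃ I : ℕ, ∀ i j : ℕ, I ≤ i → I ≤ j →
        ∫⁻ X in cellN N L, ((‖(Ψ₁ (φ i)).ψ X - (Ψ₁ (φ j)).ψ X‖₊ : ℝ≥0∞)) ^ 2 ≤ ENNReal.ofReal δ) ∧
      (∀ δ : ℝ, 0 < δ → ∃ I : ℕ, ∀ i j : ℕ, I ≤ i → I ≤ j →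
        ∫⁻ X in cellN N L, ((‖(Ψ₂ (φ i)).ψ X - (Ψ₂ (φ j)).ψ X‖₊ : ℝ≥0∞)) ^ 2 ≤ ENNReal.ofReal δ) := by
  obtain ⟨φ₁, hφ₁, hC₁⟩ := exists_subseq_sq_cauchy_of_le hv hL hB Ψ₁ id (fun _ => le_rfl) h₁
  obtain ⟨φ₂, hφ₂, hC₂⟩ := exists_subseq_sq_cauchy_of_le hv hL hB (fun n => Ψ₂ (φ₁ n)) φ₁
    (fun _ => hφ₁.le_apply) fun n => h₂ (φ₁ n)
  refine ⟨fun i => φ₁ (φ₂ i), hφ₁.comp hφ₂, fun δ hδ => ?_, fun δ hδ => ?_⟩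
  · obtain ⟨I, hI⟩ := hC₁ δ hδ
    exact ⟨I, fun i j hi hj => hI (φ₂ i) (φ₂ j) (hi.trans hφ₂.le_apply) (hj.trans hφ₂.le_apply)⟩
  · obtain ⟨I, hI⟩ := hC₂ δ hδ
    exact ⟨I, fun i j hi hj => hI i j hi hj⟩

/-! ### (P3) Pointwise domination and bookkeeping for the pair -/

/-- Pointwise domination of the pair's kinetic density by a reference pair and the two differences:
`|∇b₁|² + |∇b₂|² ≤ 2((|∇a₁|² + |∇a₂|²) + (|∇(b₁ - a₁)|² + |∇(b₂ - a₂)|²))` (for each component the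
parallelogram law `kineticDensity_fun_add_add_sub` on `a + (b - a) = b`, dropping a square). [folklore] -/
theorem kineticDensity_pair_le_two_mul {a₁ a₂ b₁ b₂ : Config N → ℂ} (ha₁ : Differentiable ℝ a₁)
    (ha₂ : Differentiable ℝ a₂) (hb₁ : Differentiable ℝ b₁) (hb₂ : Differentiable ℝ b₂) (X : Config N) :
    kineticDensity b₁ X + kineticDensity b₂ X ≤
      2 * ((kineticDensity a₁ X + kineticDensity a₂ X) +
        (kineticDensity (fun Y => b₁ Y - a₁ Y) X + kineticDensity (fun Y => b₂ Y - a₂ Y) X)) := by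
  -- `|∇b|² ≤ 2(|∇a|² + |∇(b - a)|²)` for one component
  have hone : ∀ {a b : Config N → ℂ}, Differentiable ℝ a → Differentiable ℝ b →
      kineticDensity b X ≤ 2 * (kineticDensity a X + kineticDensity (fun Y => b Y - a Y) X) := by
    intro a b ha hb
    have h := kineticDensity_fun_add_add_sub ha (hb.fun_sub ha) X
    have hab : (fun Y => a Y + (b Y - a Y)) = b := funext fun Y => add_sub_cancel (a Y) (b Y)
    rw [hab] at h
    rw [← h]
    exact le_self_add
  calc kineticDensity b₁ X + kineticDensity b₂ X
      ≤ 2 * (kineticDensity a₁ X + kineticDensity (fun Y => b₁ Y - a₁ Y) X) +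
          2 * (kineticDensity a₂ X + kineticDensity (fun Y => b₂ Y - a₂ Y) X) :=
        add_le_add (hone ha₁ hb₁) (hone ha₂ hb₂)
    _ = _ := by ring

/-- The `ε/2 + ε/2` bookkeeping of the pair tightness estimate, in `ℝ≥0∞`:
`2a + 2q ≤ ε` once `a ≤ ε/4` and `q ≤ 2(ε/32) + 4(ε/64) + ε/8`. [folklore] -/
theorem pair_bookkeeping {ε : ℝ} (hε : 0 < ε) {a q : ℝ≥0∞} (ha : a ≤ ENNReal.ofReal (ε / 4))
    (hq : q ≤ 2 * ENNReal.ofReal (ε / 32) + 4 * ENNReal.ofReal (ε / 64) + ENNReal.ofReal (ε / 8)) :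
    2 * a + 2 * q ≤ ENNReal.ofReal ε := by
  have h2 : ∀ x : ℝ, 2 * ENNReal.ofReal x = ENNReal.ofReal (2 * x) := fun x => by
    rw [ENNReal.ofReal_mul (by norm_num : (0 : ℝ) ≤ 2), ENNReal.ofReal_ofNat]
  have h4 : ∀ x : ℝ, 4 * ENNReal.ofReal x = ENNReal.ofReal (4 * x) := fun x => by
    rw [ENNReal.ofReal_mul (by norm_num : (0 : ℝ) ≤ 4), ENNReal.ofReal_ofNat]
  calc 2 * a + 2 * q
      ≤ 2 * ENNReal.ofReal (ε / 4) +
          2 * (2 * ENNReal.ofReal (ε / 32) + 4 * ENNReal.ofReal (ε / 64) + ENNReal.ofReal (ε / 8)) := by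
        gcongr
    _ = ENNReal.ofReal ε := by
        rw [h2 (ε / 32), h4, ← ENNReal.ofReal_add (by positivity) (by positivity),
          ← ENNReal.ofReal_add (by positivity) (by positivity), h2, h2,
          ← ENNReal.ofReal_add (by positivity) (by positivity)]
        congr 1
        ring

end PairKineticTightness

open PairKineticTightness

/-- **Q3 `stub_pairKineticTightness_of`** (kinetic tightness of near-optimal orthonormal pairs along the truncations,
from the trace-Cauchy estimate Q2). For `1/(n+1)`-optimal orthonormal pairs `(Ψ₁ n, Ψ₂ n)` of `K₂(wₙ) ≤ B < ⊤` there
is a subsequence `φ` along which the total kinetic energy of the pair does not concentrate on any shrinking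
measurable family with Lebesgue-null limit in the cell. Proof = that of `stub_truncationMinimisersKineticTightness`
(`…KineticTightness.lean`): two Rellich extractions (`exists_subseq_sq_cauchy_of_le`, the second on
`n ↦ Ψ₂ (φ₁ n)` using `q_{wₙ} ≤ q_{w_{φ₁ n}}`), monotone bounded `K₂(wₙ)` (`exists_kyFanTwo_increment_le`), Q2
between `φ i₀` and `φ i` with `δ = 1/(φ i₀ + 1)`, pointwise domination
`|∇Ψᵢ|² ≤ 2|∇Ψ_{i₀}|² + 2|∇(Ψᵢ - Ψ_{i₀})|²`, absolute continuity (`exists_setLIntegral_inter_cellN_le`). [folklore] -/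
theorem stub_pairKineticTightness_of :
    (∀ (v : ℝ → ℝ≥0∞), Measurable v → ∀ (N : ℕ) (L : ℝ), 0 < L → ∀ (m n : ℕ), m ≤ n →
      ∀ (δ η : ℝ), 0 ≤ δ → 0 ≤ η → η ≤ 1 / 16 →
      ∀ Φ₁ Φ₂ Ψ₁ Ψ₂ : PeriodicTrialState N L,
        (∫ X in cellN N L, conj (Φ₁.ψ X) * Φ₂.ψ X = 0) → (∫ X in cellN N L, conj (Ψ₁.ψ X) * Ψ₂.ψ X = 0) →
        periodicEnergy (fun r => min (v r) (m : ℝ≥0∞)) Φ₁ + periodicEnergy (fun r => min (v r) (m : ℝ≥0∞)) Φ₂ ≤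
          kyFanTwo (fun r => min (v r) (m : ℝ≥0∞)) N L + ENNReal.ofReal δ →
        periodicEnergy (fun r => min (v r) (n : ℝ≥0∞)) Ψ₁ + periodicEnergy (fun r => min (v r) (n : ℝ≥0∞)) Ψ₂ ≤
          kyFanTwo (fun r => min (v r) (n : ℝ≥0∞)) N L + ENNReal.ofReal δ →
        kyFanTwo (fun r => min (v r) (n : ℝ≥0∞)) N L ≠ ⊤ →
        ∫⁻ X in cellN N L, ((‖Ψ₁.ψ X - Φ₁.ψ X‖₊ : ℝ≥0∞)) ^ 2 ≤ ENNReal.ofReal η →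
        ∫⁻ X in cellN N L, ((‖Ψ₂.ψ X - Φ₂.ψ X‖₊ : ℝ≥0∞)) ^ 2 ≤ ENNReal.ofReal η →
        (∫⁻ X in cellN N L, kineticDensity (fun Y => Ψ₁.ψ Y - Φ₁.ψ Y) X +
            periodicInteraction (fun r => min (v r) (m : ℝ≥0∞)) L X * ((‖Ψ₁.ψ X - Φ₁.ψ X‖₊ : ℝ≥0∞)) ^ 2) +
          (∫⁻ X in cellN N L, kineticDensity (fun Y => Ψ₂.ψ Y - Φ₂.ψ Y) X +
            periodicInteraction (fun r => min (v r) (m : ℝ≥0∞)) L X * ((‖Ψ₂.ψ X - Φ₂.ψ X‖₊ : ℝ≥0∞)) ^ 2) ≤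
          2 * (kyFanTwo (fun r => min (v r) (n : ℝ≥0∞)) N L - kyFanTwo (fun r => min (v r) (m : ℝ≥0∞)) N L) +
            4 * ENNReal.ofReal δ +
            ENNReal.ofReal (64 * Real.sqrt η) * (kyFanTwo (fun r => min (v r) (n : ℝ≥0∞)) N L + ENNReal.ofReal δ)) →
    ∀ (v : ℝ → ℝ≥0∞), Measurable v → ∀ (N : ℕ) (L : ℝ), 0 < L → ∀ B : ℝ≥0∞, B ≠ ⊤ →
      ∀ Ψ₁ Ψ₂ : ℕ → PeriodicTrialState N L,
        (∀ n : ℕ, ∫ X in cellN N L, conj ((Ψ₁ n).ψ X) * (Ψ₂ n).ψ X = 0) →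
        (∀ n : ℕ, periodicEnergy (fun r => min (v r) (n : ℝ≥0∞)) (Ψ₁ n) +
            periodicEnergy (fun r => min (v r) (n : ℝ≥0∞)) (Ψ₂ n) ≤
          kyFanTwo (fun r => min (v r) (n : ℝ≥0∞)) N L + ENNReal.ofReal (1 / ((n : ℝ) + 1))) →
        (∀ n : ℕ, kyFanTwo (fun r => min (v r) (n : ℝ≥0∞)) N L ≤ B) →
        ∃ φ : ℕ → ℕ, StrictMono φ ∧
          ∀ S : ℕ → Set (Config N), (∀ k, MeasurableSet (S k)) → Antitone S →
            volume ((⋂ k, S k) ∩ cellN N L) = 0 →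
            ∀ ε : ℝ, 0 < ε → ∃ k₀ i₀ : ℕ, ∀ k i : ℕ, k₀ ≤ k → i₀ ≤ i →
              ∫⁻ X in S k ∩ cellN N L, kineticDensity (Ψ₁ (φ i)).ψ X + kineticDensity (Ψ₂ (φ i)).ψ X ≤
                ENNReal.ofReal ε := by
  intro htrace v hv N L hL B hB Ψ₁ Ψ₂ horth hopt hKB
  -- (P1) both components have truncated energies `≤ B + 1`; a common `L²(cell)`-Cauchy subsequence
  have hB1 : B + 1 ≠ ⊤ := ENNReal.add_ne_top.2 ⟨hB, ENNReal.one_ne_top⟩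
  have hone : ∀ n : ℕ, ENNReal.ofReal (1 / ((n : ℝ) + 1)) ≤ 1 := fun n =>
    ENNReal.ofReal_le_one.2 ((div_le_one (Nat.cast_add_one_pos n)).2
      (le_add_of_nonneg_left (Nat.cast_nonneg n)))
  have hsum : ∀ n : ℕ, periodicEnergy (fun r => min (v r) (n : ℝ≥0∞)) (Ψ₁ n) +
      periodicEnergy (fun r => min (v r) (n : ℝ≥0∞)) (Ψ₂ n) ≤ B + 1 :=
    fun n => (hopt n).trans (add_le_add (hKB n) (hone n))
  obtain ⟨φ, hφ, hC₁, hC₂⟩ := exists_subseq_pair_sq_cauchy hv hL hB1 Ψ₁ Ψ₂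
    (fun n => le_self_add.trans (hsum n)) (fun n => le_add_self.trans (hsum n))
  refine ⟨φ, hφ, fun S hS hanti hnull ε hε => ?_⟩
  -- (P2') increments of the monotone bounded truncated Ky Fan two-levels
  obtain ⟨I₁, hI₁⟩ := exists_kyFanTwo_increment_le v N L hB hKB
    (ENNReal.ofReal_pos.2 (by positivity : (0 : ℝ) < ε / 32))
  -- the `L²(cell)` tolerance `η`, the Cauchy indices, the index beyond which `4/(n+1)` is small
  have hb : 0 ≤ B.toReal := ENNReal.toReal_nonneg
  have hB1eq : B + 1 = ENNReal.ofReal (B.toReal + 1) := by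
    rw [ENNReal.ofReal_add hb zero_le_one, ENNReal.ofReal_toReal hB, ENNReal.ofReal_one]
  obtain ⟨η, hη0, hη16, hsqrt⟩ : ∃ η : ℝ, 0 < η ∧ η ≤ 1 / 16 ∧
      Real.sqrt η ≤ ε / (512 * (B.toReal + 1)) :=
    ⟨min (1 / 16) ((ε / (512 * (B.toReal + 1))) ^ 2), lt_min (by norm_num) (by positivity),
      min_le_left _ _, (Real.sqrt_le_sqrt (min_le_right _ _)).trans (Real.sqrt_sq (by positivity)).le⟩
  obtain ⟨I₂, hI₂⟩ := hC₁ η hη0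
  obtain ⟨I₃, hI₃⟩ := hC₂ η hη0
  obtain ⟨I₄, hI₄⟩ := exists_nat_ge (64 / ε)
  -- the reference index `i₀` and the tail index `k₀` of the fixed reference pair `(Ψ₁ (φ i₀), Ψ₂ (φ i₀))`
  obtain ⟨i₀, hi₀⟩ : ∃ i₀ : ℕ, i₀ = I₁ + I₂ + I₃ + I₄ := ⟨_, rfl⟩
  have hkinfin : ∫⁻ X in cellN N L,
      kineticDensity (Ψ₁ (φ i₀)).ψ X + kineticDensity (Ψ₂ (φ i₀)).ψ X ≠ ⊤ := by
    rw [lintegral_add_left (measurable_kineticDensity_of_any _)]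
    exact ENNReal.add_ne_top.2
      ⟨ne_top_of_le_ne_top hB1 ((lintegral_mono fun _ => le_self_add).trans (le_self_add.trans (hsum _))),
        ne_top_of_le_ne_top hB1 ((lintegral_mono fun _ => le_self_add).trans (le_add_self.trans (hsum _)))⟩
  obtain ⟨k₀, hk₀⟩ := exists_setLIntegral_inter_cellN_le hkinfin S hS hanti hnull
    (ENNReal.ofReal_pos.2 (by positivity : (0 : ℝ) < ε / 4))
  refine ⟨k₀, i₀, fun k i hk hi => ?_⟩
  have hI₁i₀ : I₁ ≤ φ i₀ := (by omega : I₁ ≤ i₀).trans hφ.le_apply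
  have hI₂i₀ : I₂ ≤ i₀ := by omega
  have hI₃i₀ : I₃ ≤ i₀ := by omega
  have hI₄i₀ : (64 / ε : ℝ) ≤ (φ i₀ : ℝ) :=
    hI₄.trans (by exact_mod_cast (by omega : I₄ ≤ i₀).trans hφ.le_apply)
  -- (P2) the trace-Cauchy estimate between the `φ i₀`-pair and the `φ i`-pair
  have hmn : φ i₀ ≤ φ i := hφ.monotone hi
  have hδ0 : (0 : ℝ) ≤ 1 / ((φ i₀ : ℝ) + 1) := by positivity
  have hopt' : periodicEnergy (fun r => min (v r) ((φ i : ℕ) : ℝ≥0∞)) (Ψ₁ (φ i)) +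
      periodicEnergy (fun r => min (v r) ((φ i : ℕ) : ℝ≥0∞)) (Ψ₂ (φ i)) ≤
      kyFanTwo (fun r => min (v r) ((φ i : ℕ) : ℝ≥0∞)) N L + ENNReal.ofReal (1 / ((φ i₀ : ℝ) + 1)) :=
    (hopt (φ i)).trans (add_le_add le_rfl (ENNReal.ofReal_le_ofReal
      (one_div_le_one_div_of_le (by positivity) (by exact_mod_cast Nat.add_le_add_right hmn 1))))
  have hQ := htrace v hv N L hL (φ i₀) (φ i) hmn (1 / ((φ i₀ : ℝ) + 1)) η hδ0 hη0.le hη16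
    (Ψ₁ (φ i₀)) (Ψ₂ (φ i₀)) (Ψ₁ (φ i)) (Ψ₂ (φ i)) (horth (φ i₀)) (horth (φ i)) (hopt (φ i₀)) hopt'
    (ne_top_of_le_ne_top hB (hKB (φ i))) (hI₂ i i₀ (hI₂i₀.trans hi) hI₂i₀)
    (hI₃ i i₀ (hI₃i₀.trans hi) hI₃i₀)
  -- the three error terms: increment, optimality defect, `L²(cell)`-distance
  have hinc : kyFanTwo (fun r => min (v r) ((φ i : ℕ) : ℝ≥0∞)) N L -
      kyFanTwo (fun r => min (v r) ((φ i₀ : ℕ) : ℝ≥0∞)) N L ≤ ENNReal.ofReal (ε / 32) :=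
    hI₁ (φ i₀) (φ i) hI₁i₀
  have hδε : ENNReal.ofReal (1 / ((φ i₀ : ℝ) + 1)) ≤ ENNReal.ofReal (ε / 64) := by
    refine ENNReal.ofReal_le_ofReal ?_
    calc 1 / ((φ i₀ : ℝ) + 1) ≤ 1 / (64 / ε) :=
          one_div_le_one_div_of_le (by positivity) (hI₄i₀.trans (le_add_of_nonneg_right zero_le_one))
      _ = ε / 64 := one_div_div _ _
  have hreal : 64 * Real.sqrt η * (B.toReal + 1) ≤ ε / 8 := by
    have h1 : Real.sqrt η * (512 * (B.toReal + 1)) ≤ ε := (le_div_iff₀ (by positivity)).1 hsqrt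
    calc 64 * Real.sqrt η * (B.toReal + 1) = Real.sqrt η * (512 * (B.toReal + 1)) / 8 := by ring
      _ ≤ ε / 8 := by gcongr
  have hs : ENNReal.ofReal (64 * Real.sqrt η) *
      (kyFanTwo (fun r => min (v r) ((φ i : ℕ) : ℝ≥0∞)) N L + ENNReal.ofReal (1 / ((φ i₀ : ℝ) + 1))) ≤
      ENNReal.ofReal (ε / 8) :=
    calc ENNReal.ofReal (64 * Real.sqrt η) *
          (kyFanTwo (fun r => min (v r) ((φ i : ℕ) : ℝ≥0∞)) N L + ENNReal.ofReal (1 / ((φ i₀ : ℝ) + 1)))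
        ≤ ENNReal.ofReal (64 * Real.sqrt η) * (B + 1) := mul_le_mul_right (add_le_add (hKB _) (hone _)) _
      _ = ENNReal.ofReal (64 * Real.sqrt η * (B.toReal + 1)) := by
          rw [hB1eq, ← ENNReal.ofReal_mul (by positivity)]
      _ ≤ ENNReal.ofReal (ε / 8) := ENNReal.ofReal_le_ofReal hreal
  have hQ' := hQ.trans (add_le_add (add_le_add (mul_le_mul_right hinc 2) (mul_le_mul_right hδε 4)) hs)
  -- the kinetic energies of the two differences on the whole cell
  have hdiff : (∫⁻ X in cellN N L, kineticDensity (fun Y => (Ψ₁ (φ i)).ψ Y - (Ψ₁ (φ i₀)).ψ Y) X) +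
      (∫⁻ X in cellN N L, kineticDensity (fun Y => (Ψ₂ (φ i)).ψ Y - (Ψ₂ (φ i₀)).ψ Y) X) ≤
      2 * ENNReal.ofReal (ε / 32) + 4 * ENNReal.ofReal (ε / 64) + ENNReal.ofReal (ε / 8) := by
    refine le_trans ?_ hQ'
    exact add_le_add (lintegral_mono fun _ => le_self_add) (lintegral_mono fun _ => le_self_add)
  -- (P3) pointwise domination, integration over `S k ∩ cell`, bookkeeping
  have hd₁ : Differentiable ℝ (Ψ₁ (φ i)).ψ := (Ψ₁ (φ i)).contDiff.differentiable one_ne_zero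
  have hd₂ : Differentiable ℝ (Ψ₂ (φ i)).ψ := (Ψ₂ (φ i)).contDiff.differentiable one_ne_zero
  have hd₁₀ : Differentiable ℝ (Ψ₁ (φ i₀)).ψ := (Ψ₁ (φ i₀)).contDiff.differentiable one_ne_zero
  have hd₂₀ : Differentiable ℝ (Ψ₂ (φ i₀)).ψ := (Ψ₂ (φ i₀)).contDiff.differentiable one_ne_zero
  calc ∫⁻ X in S k ∩ cellN N L, kineticDensity (Ψ₁ (φ i)).ψ X + kineticDensity (Ψ₂ (φ i)).ψ X
      ≤ ∫⁻ X in S k ∩ cellN N L, 2 * ((kineticDensity (Ψ₁ (φ i₀)).ψ X + kineticDensity (Ψ₂ (φ i₀)).ψ X) +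
          (kineticDensity (fun Y => (Ψ₁ (φ i)).ψ Y - (Ψ₁ (φ i₀)).ψ Y) X +
            kineticDensity (fun Y => (Ψ₂ (φ i)).ψ Y - (Ψ₂ (φ i₀)).ψ Y) X)) :=
        lintegral_mono fun X => kineticDensity_pair_le_two_mul hd₁₀ hd₂₀ hd₁ hd₂ X
    _ = 2 * (∫⁻ X in S k ∩ cellN N L,
            (kineticDensity (Ψ₁ (φ i₀)).ψ X + kineticDensity (Ψ₂ (φ i₀)).ψ X)) +
          2 * ∫⁻ X in S k ∩ cellN N L, (kineticDensity (fun Y => (Ψ₁ (φ i)).ψ Y - (Ψ₁ (φ i₀)).ψ Y) X +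
            kineticDensity (fun Y => (Ψ₂ (φ i)).ψ Y - (Ψ₂ (φ i₀)).ψ Y) X) := by
        rw [lintegral_const_mul' _ _ ENNReal.ofNat_ne_top,
          lintegral_add_left
            ((measurable_kineticDensity_of_any _).fun_add (measurable_kineticDensity_of_any _)),
          mul_add]
    _ ≤ 2 * (∫⁻ X in S k ∩ cellN N L,
            (kineticDensity (Ψ₁ (φ i₀)).ψ X + kineticDensity (Ψ₂ (φ i₀)).ψ X)) +
          2 * ((∫⁻ X in cellN N L, kineticDensity (fun Y => (Ψ₁ (φ i)).ψ Y - (Ψ₁ (φ i₀)).ψ Y) X) +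
            ∫⁻ X in cellN N L, kineticDensity (fun Y => (Ψ₂ (φ i)).ψ Y - (Ψ₂ (φ i₀)).ψ Y) X) :=
        add_le_add le_rfl (mul_le_mul_right ((lintegral_mono_set Set.inter_subset_right).trans
          (lintegral_add_left (measurable_kineticDensity_of_any _) _).le) 2)
    _ ≤ ENNReal.ofReal ε := pair_bookkeeping hε (hk₀ k hk) hdiff

end Summit.AtomisticToContinuum.BoseEinsteinCondensation.Cruxes.HardCoreExtension.ThirdLawCurrentFloor

end
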